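import Literature.Computability.AlgebraicComplexity.SupportFunctionalRestriction
import HarnessLib

/-!
# The upper support functional of Kronecker powers: `ρ^θ(t^{⊗N}) ≤ N · H_θ(supp t)`

Topic: `Literature/Computability/AlgebraicComplexity` (support file for Strassen's support functionals,
`QuantumFunctionals.lean`). The sub-multiplicativity of Strassen's upper support functional
([Str91]; CVZ Thm. 2.4(3): `ζ^θ(s ⊗ t) ≤ ζ^θ(s) ζ^θ(t)`) in the iterated form in which the barrier
files use it: for every `θ ≥ 0`, every tensor `t` with finite index types and every `N`,
`ρ^θ(t^{⊗N}) ≤ N · H_θ(supp t)` (`logUpperSupportFunctional_kroneckerPow_le`), where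
`t^{⊗N} = kroneckerPow t N` lives on the index types `Fin N → ι` etc. and `H_θ(supp t)` is the maximal
`θ`-weighted marginal entropy of the support of `t` in the standard bases; hence
`ζ^θ(t^{⊗N}) ≤ 2^{N h}` whenever `H_θ(supp t) ≤ h` (e.g. a dual certificate).

## Proof

* `shannonEntropy_pi_le_sum` — subadditivity of the Shannon entropy over the coordinates of a
  distribution `R` on `J → X`: `H(R) ≤ ∑ⱼ H(R⁽ʲ⁾)`, `R⁽ʲ⁾(a) = ∑_{f : f j = a} R(f)` (Gibbs' inequality
  `shannonEntropy_le_sum_mul_neg_logb` of `WeightedEntropyMax.lean` with the product `∏ⱼ R⁽ʲ⁾(f j)` of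
  the coordinate marginals as reference sub-probability vector).
* `weightedEntropy_le_sum_coordinates` — for a distribution `P` on
  `(J → ι) × (J → κ) × (J → μ)`: `H_θ(P) ≤ ∑ⱼ H_θ(P⁽ʲ⁾)` with `P⁽ʲ⁾` the push-forward along the `j`-th
  coordinate projections (its marginals are the coordinate marginals, `marginalDistᵢ_pushforward` of
  `SupportFunctionalRestriction.lean`).
* `maxWeightedEntropy_kroneckerPow_le` — `supp (t^{⊗N}) = {x | ∀ j, (x₁ j, x₂ j, x₃ j) ∈ supp t}`, so
  every `P⁽ʲ⁾` is supported in `supp t` and `H_θ(supp t^{⊗N}) ≤ N · H_θ(supp t)`; with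
  `ρ^θ ≤ H_θ(supp)` (standard bases, `logUpperSupportFunctional_le`) the main bound follows.

No definitions are introduced. References: V. Strassen, J. reine angew. Math. 413 (1991), Thm. 2.8;
M. Christandl, P. Vrana, J. Zuiddam, J. Amer. Math. Soc. 36 (2023), Thm. 2.4.
-/

noncomputable section

open scoped BigOperators

namespace Literature.Computability.AlgebraicComplexity

/-! ## Subadditivity of the entropy over coordinates -/

section Subadditivity

variable {J X : Type*} [Fintype J] [DecidableEq J] [Fintype X] [DecidableEq X]

/-- A coordinate marginal `R⁽ʲ⁾(a) = ∑_{f : f j = a} R(f)` of a probability vector on `J → X` is a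
probability vector, and dominates `R` on its fibre. [folklore] -/
theorem coordMarginal_mem_stdSimplex {R : (J → X) → ℝ} (hR : R ∈ stdSimplex ℝ (J → X)) (j : J) :
    (fun a => ∑ f ∈ Finset.univ.filter (fun f : J → X => f j = a), R f) ∈ stdSimplex ℝ X ∧
      ∀ f : J → X, R f ≤ ∑ f' ∈ Finset.univ.filter (fun f' : J → X => f' j = f j), R f' := by
  classical
  refine ⟨⟨fun a => Finset.sum_nonneg fun f _ => hR.1 f, ?_⟩, fun f => ?_⟩
  · rw [Finset.sum_fiberwise_of_maps_to (fun f _ => Finset.mem_univ (f j))]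
    exact hR.2
  · exact Finset.single_le_sum (fun f' _ => hR.1 f') (by simp)

/-- **Subadditivity of the Shannon entropy over coordinates**: for a probability distribution `R` on
`J → X`, `H(R) ≤ ∑ⱼ H(R⁽ʲ⁾)` with `R⁽ʲ⁾` the `j`-th coordinate marginal (Gibbs' inequality against the
product of the coordinate marginals). [folklore] -/
theorem shannonEntropy_pi_le_sum {R : (J → X) → ℝ} (hR : R ∈ stdSimplex ℝ (J → X)) :
    shannonEntropy R ≤
      ∑ j, shannonEntropy (fun a => ∑ f ∈ Finset.univ.filter (fun f : J → X => f j = a), R f) := by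
  classical
  -- coordinate marginals `q j`
  set q : J → X → ℝ := fun j a => ∑ f ∈ Finset.univ.filter (fun f : J → X => f j = a), R f with hq
  have hqs : ∀ j, q j ∈ stdSimplex ℝ X := fun j => (coordMarginal_mem_stdSimplex hR j).1
  have hRq : ∀ j f, R f ≤ q j (f j) := fun j f => (coordMarginal_mem_stdSimplex hR j).2 f
  -- reference vector `Q f = ∏ j, q j (f j)`
  have hQ0 : ∀ f : J → X, 0 ≤ ∏ j, q j (f j) := fun f => Finset.prod_nonneg fun j _ => (hqs j).1 _
  have hQ1 : ∑ f : J → X, ∏ j, q j (f j) ≤ 1 := by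
    have h := Finset.sum_prod_piFinset (Finset.univ : Finset X) q
    rw [Fintype.piFinset_univ] at h
    rw [h, Finset.prod_eq_one fun j _ => (hqs j).2]
  have hpos : ∀ f : J → X, R f ≠ 0 → ∀ j, 0 < q j (f j) := fun f hf j =>
    lt_of_lt_of_le (lt_of_le_of_ne (hR.1 f) (Ne.symm hf)) (hRq j f)
  have hPQ : ∀ f : J → X, R f ≠ 0 → 0 < ∏ j, q j (f j) := fun f hf =>
    Finset.prod_pos fun j _ => hpos f hf j
  refine (shannonEntropy_le_sum_mul_neg_logb hR.1 hR.2 hQ0 hQ1 hPQ).trans (le_of_eq ?_)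
  -- `-log ∏ = ∑ -log` on the support of `R`
  have hlog : ∀ f : J → X, R f * (-Real.log (∏ j, q j (f j)) / Real.log 2) =
      ∑ j, R f * (-Real.log (q j (f j)) / Real.log 2) := by
    intro f
    rcases eq_or_ne (R f) 0 with hf | hf
    · simp [hf]
    · rw [Real.log_prod (s := Finset.univ) (fun j _ => (hpos f hf j).ne'), ← Finset.mul_sum,
        ← Finset.sum_div, Finset.sum_neg_distrib]
  rw [Finset.sum_congr rfl fun f _ => hlog f, Finset.sum_comm]
  refine Finset.sum_congr rfl fun j _ => ?_
  -- regroup the `f`-sum along the fibres of `f ↦ f j`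
  rw [shannonEntropy_def, Finset.sum_div,
    ← Finset.sum_fiberwise_of_maps_to (s := Finset.univ) (t := Finset.univ) (g := fun f : J → X => f j)
      (fun f _ => Finset.mem_univ (f j))]
  refine Finset.sum_congr rfl fun a _ => ?_
  rw [Real.negMulLog, show (∑ f ∈ Finset.univ.filter (fun f : J → X => f j = a),
      R f * (-Real.log (q j (f j)) / Real.log 2)) =
      ∑ f ∈ Finset.univ.filter (fun f : J → X => f j = a), R f * (-Real.log (q j a) / Real.log 2) from
    Finset.sum_congr rfl fun f hf => by rw [(Finset.mem_filter.1 hf).2], ← Finset.sum_mul]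
  ring

end Subadditivity

/-! ## Distributions on products of function types: coordinate push-forwards -/

section Coordinates

variable {ι κ μ : Type*} [Fintype ι] [Fintype κ] [Fintype μ]
variable [DecidableEq ι] [DecidableEq κ] [DecidableEq μ]
variable {ι' κ' μ' : Type*} [Fintype ι'] [Fintype κ'] [Fintype μ']

/-- The push-forward of a probability distribution along any map `φ₁ × φ₂ × φ₃` is a probability
distribution, charging only images of charged points. [folklore] -/
theorem pushforward_mem_stdSimplex {P : ι' × κ' × μ' → ℝ} (hP : P ∈ stdSimplex ℝ (ι' × κ' × μ'))
    (φ₁ : ι' → ι) (φ₂ : κ' → κ) (φ₃ : μ' → μ) :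
    (fun z : ι × κ × μ => ∑ x ∈ Finset.univ.filter
        (fun x : ι' × κ' × μ' => (φ₁ x.1, φ₂ x.2.1, φ₃ x.2.2) = z), P x) ∈ stdSimplex ℝ (ι × κ × μ) ∧
    ∀ z : ι × κ × μ, (∑ x ∈ Finset.univ.filter
        (fun x : ι' × κ' × μ' => (φ₁ x.1, φ₂ x.2.1, φ₃ x.2.2) = z), P x) ≠ 0 →
      ∃ x, P x ≠ 0 ∧ (φ₁ x.1, φ₂ x.2.1, φ₃ x.2.2) = z := by
  classical
  refine ⟨⟨fun z => Finset.sum_nonneg fun x _ => hP.1 x, ?_⟩, fun z hz => ?_⟩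
  · have h := Finset.sum_fiberwise_of_maps_to (s := Finset.univ) (t := Finset.univ)
      (g := fun x : ι' × κ' × μ' => (φ₁ x.1, φ₂ x.2.1, φ₃ x.2.2)) (fun x _ => Finset.mem_univ _) P
    rw [h]
    exact hP.2
  · obtain ⟨x, hx, hPx⟩ := Finset.exists_ne_zero_of_sum_ne_zero hz
    exact ⟨x, hPx, (Finset.mem_filter.1 hx).2⟩

variable {J : Type*} [Fintype J] [DecidableEq J]

/-- **`H_θ` is subadditive over coordinates**: for a probability distribution `P` on
`(J → ι) × (J → κ) × (J → μ)` and `θ ≥ 0`, `H_θ(P) ≤ ∑ⱼ H_θ(P⁽ʲ⁾)`, `P⁽ʲ⁾` being the push-forward of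
`P` along the three `j`-th coordinate projections. [folklore] -/
theorem weightedEntropy_le_sum_coordinates {θ : Fin 3 → ℝ} (hθ : ∀ i, 0 ≤ θ i)
    {P : (J → ι) × (J → κ) × (J → μ) → ℝ} (hP : P ∈ stdSimplex ℝ ((J → ι) × (J → κ) × (J → μ))) :
    weightedEntropy θ P ≤ ∑ j, weightedEntropy θ (fun z : ι × κ × μ => ∑ x ∈ Finset.univ.filter
      (fun x : (J → ι) × (J → κ) × (J → μ) => (x.1 j, x.2.1 j, x.2.2 j) = z), P x) := by
  classical
  have h₁ := shannonEntropy_pi_le_sum (marginalDist₁_mem_stdSimplex hP)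
  have h₂ := shannonEntropy_pi_le_sum (marginalDist₂_mem_stdSimplex hP)
  have h₃ := shannonEntropy_pi_le_sum (marginalDist₃_mem_stdSimplex hP)
  simp only [weightedEntropy]
  rw [Finset.sum_add_distrib, Finset.sum_add_distrib, ← Finset.mul_sum, ← Finset.mul_sum,
    ← Finset.mul_sum]
  refine add_le_add (add_le_add ?_ ?_) ?_
  · refine mul_le_mul_of_nonneg_left (h₁.trans (le_of_eq (Finset.sum_congr rfl fun j _ => ?_))) (hθ 0)
    congr 1
    funext a
    exact (marginalDist₁_pushforward P (fun f : J → ι => f j) (fun f : J → κ => f j)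
      (fun f : J → μ => f j) a).symm
  · refine mul_le_mul_of_nonneg_left (h₂.trans (le_of_eq (Finset.sum_congr rfl fun j _ => ?_))) (hθ 1)
    congr 1
    funext b
    exact (marginalDist₂_pushforward P (fun f : J → ι => f j) (fun f : J → κ => f j)
      (fun f : J → μ => f j) b).symm
  · refine mul_le_mul_of_nonneg_left (h₃.trans (le_of_eq (Finset.sum_congr rfl fun j _ => ?_))) (hθ 2)
    congr 1
    funext c
    exact (marginalDist₃_pushforward P (fun f : J → ι => f j) (fun f : J → κ => f j)
      (fun f : J → μ => f j) c).symm

end Coordinates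

/-! ## Kronecker powers -/

section Powers

variable {K : Type*} [Field K] {ι κ μ : Type*} [Fintype ι] [Fintype κ] [Fintype μ]
variable [DecidableEq ι] [DecidableEq κ] [DecidableEq μ]

omit [Fintype ι] [Fintype κ] [Fintype μ] [DecidableEq ι] [DecidableEq κ] [DecidableEq μ] in
/-- The support of a Kronecker power in the standard (product) bases: `x ∈ supp (t^{⊗N})` iff every
coordinate triple `(x₁ j, x₂ j, x₃ j)` lies in `supp t`. [folklore] -/
theorem mem_tensorSupport_kroneckerPow (t : ι → κ → μ → K) (N : ℕ)
    (x : (Fin N → ι) × (Fin N → κ) × (Fin N → μ)) :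
    x ∈ tensorSupport (kroneckerPow t N) ↔ ∀ j, (x.1 j, x.2.1 j, x.2.2 j) ∈ tensorSupport t := by
  simp only [mem_tensorSupport, kroneckerPow_apply, Finset.prod_ne_zero_iff, Finset.mem_univ,
    true_implies]

/-- **`H_θ(supp t^{⊗N}) ≤ N · H_θ(supp t)`** for `θ ≥ 0`: every coordinate push-forward of a
distribution on `supp (t^{⊗N})` is a distribution on `supp t`.
[cite: ChristandlVranaZuiddam2023, Thm. 2.4] -/
theorem maxWeightedEntropy_kroneckerPow_le {θ : Fin 3 → ℝ} (hθ : ∀ i, 0 ≤ θ i)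
    (t : ι → κ → μ → K) (N : ℕ) :
    maxWeightedEntropy θ (tensorSupport (kroneckerPow t N)) ≤
      N * maxWeightedEntropy θ (tensorSupport t) := by
  classical
  refine Real.sSup_le ?_ (mul_nonneg (Nat.cast_nonneg N) (maxWeightedEntropy_nonneg hθ _))
  rintro _ ⟨P, ⟨hP, hsupp⟩, rfl⟩
  refine (weightedEntropy_le_sum_coordinates hθ hP).trans ?_
  calc ∑ j : Fin N, weightedEntropy θ (fun z : ι × κ × μ => ∑ x ∈ Finset.univ.filter
          (fun x : (Fin N → ι) × (Fin N → κ) × (Fin N → μ) => (x.1 j, x.2.1 j, x.2.2 j) = z), P x)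
      ≤ ∑ _j : Fin N, maxWeightedEntropy θ (tensorSupport t) := by
        refine Finset.sum_le_sum fun j _ => ?_
        obtain ⟨hPj, hPjs⟩ := pushforward_mem_stdSimplex hP (fun f : Fin N → ι => f j)
          (fun f : Fin N → κ => f j) (fun f : Fin N → μ => f j)
        refine weightedEntropy_le_maxWeightedEntropy hθ hPj fun z hz => ?_
        obtain ⟨x, hPx, rfl⟩ := hPjs z hz
        exact (mem_tensorSupport_kroneckerPow t N x).1 (hsupp (Function.mem_support.2 hPx)) j
    _ = N * maxWeightedEntropy θ (tensorSupport t) := by simp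

/-- **Strassen's sub-multiplicativity, iterated: `ρ^θ(t^{⊗N}) ≤ N · H_θ(supp t)`** for every `θ ≥ 0`
(`ρ^θ = log₂ ζ^θ`; the standard bases of `t^{⊗N}` are one choice of bases, and
`H_θ(supp t^{⊗N}) ≤ N · H_θ(supp t)`). [cite: ChristandlVranaZuiddam2023, Thm. 2.4] -/
theorem logUpperSupportFunctional_kroneckerPow_le {θ : Fin 3 → ℝ} (hθ : ∀ i, 0 ≤ θ i)
    (t : ι → κ → μ → K) (N : ℕ) :
    logUpperSupportFunctional θ (kroneckerPow t N) ≤ N * maxWeightedEntropy θ (tensorSupport t) :=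
  (logUpperSupportFunctional_le hθ _).trans (maxWeightedEntropy_kroneckerPow_le hθ t N)

/-- With a bound `H_θ(supp t) ≤ h` (e.g. from a dual certificate): `ρ^θ(t^{⊗N}) ≤ N h`.
[cite: ChristandlVranaZuiddam2023, Thm. 2.4] -/
theorem logUpperSupportFunctional_kroneckerPow_le_of_le {θ : Fin 3 → ℝ} (hθ : ∀ i, 0 ≤ θ i)
    (t : ι → κ → μ → K) (N : ℕ) {h : ℝ} (hh : maxWeightedEntropy θ (tensorSupport t) ≤ h) :
    logUpperSupportFunctional θ (kroneckerPow t N) ≤ N * h :=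
  (logUpperSupportFunctional_kroneckerPow_le hθ t N).trans
    (mul_le_mul_of_nonneg_left hh (Nat.cast_nonneg N))

/-- **The lower bound along a restriction of a power to an oblique tensor**: if `t^{⊗N} ≥ u`
(restriction) with `supp u` an antichain for injective weights and `P` is a probability distribution
on `supp u`, then `H_θ(P) ≤ N · H_θ(supp t)` (`θ ≥ 0`) — the inequality
`ζ_θ(u) ≤ ζ^θ(u) ≤ ζ^θ(t^{⊗N}) ≤ ζ^θ(t)^N` of Strassen's theory that drives the barriers of CLLZ 2025
(Thm. 3.10/3.15 with `F = ζ^θ`). [cite: ChristandlVranaZuiddam2023, Thm. 2.4] -/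
theorem weightedEntropy_le_mul_of_kroneckerPow_restrictsTo {ι' κ' μ' : Type*} [Fintype ι']
    [Fintype κ'] [Fintype μ'] [DecidableEq ι'] [DecidableEq κ'] [DecidableEq μ']
    {W₁ W₂ W₃ : Type*} [LinearOrder W₁] [LinearOrder W₂] [LinearOrder W₃]
    {θ : Fin 3 → ℝ} (hθ : ∀ i, 0 ≤ θ i) (t : ι → κ → μ → K) (N : ℕ) (u : ι' → κ' → μ' → K)
    (htu : TensorRestrictsTo (kroneckerPow t N) u) (w₁ : ι' → W₁) (w₂ : κ' → W₂) (w₃ : μ' → W₃)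
    (hw₁ : Function.Injective w₁) (hw₂ : Function.Injective w₂) (hw₃ : Function.Injective w₃)
    (hanti : ∀ x ∈ tensorSupport u, ∀ y ∈ tensorSupport u,
      w₁ x.1 ≤ w₁ y.1 → w₂ x.2.1 ≤ w₂ y.2.1 → w₃ x.2.2 ≤ w₃ y.2.2 → y = x)
    {P : ι' × κ' × μ' → ℝ} (hP : P ∈ stdSimplex ℝ (ι' × κ' × μ'))
    (hPs : Function.support P ⊆ tensorSupport u) :
    weightedEntropy θ P ≤ N * maxWeightedEntropy θ (tensorSupport t) :=
  (weightedEntropy_le_logUpperSupportFunctional_of_restrictsTo _ u htu w₁ w₂ w₃ hw₁ hw₂ hw₃ hanti hθ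
    hP hPs).trans (logUpperSupportFunctional_kroneckerPow_le hθ t N)

end Powers

end Literature.Computability.AlgebraicComplexity

end
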